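import Literature.NumberTheory.Automorphic.MeanSquareUpperGL2
import Literature.NumberTheory.Automorphic.WhittakerFactorizationGL2
import Literature.NumberTheory.Automorphic.IdelicDyadicUnfolding
import Literature.NumberTheory.Automorphic.AdelicVectorHeightCompact
import Literature.NumberTheory.GaloisRepresentations.UnitIdeles
import HarnessLib

/-!
# The mean-square lower bound on `GL₂`

Topic `NumberTheory/Automorphic`; namespace `Literature.NumberTheory.Automorphic`. A brick of the
mean-square route to Jacquet–Shalika's Theorem (5.3) for `GL₂`
(`StandardLFunctionData.multipliable_L`; companion of `MeanSquareUpperGL2`). Given a continuous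
`W : GL₂(𝔸_K) → ℂ` which, at every place `v` of a set `Good` of finite places, is right
`ι_v(GL₂(𝒪_v))`-invariant and satisfies Shintani's relation
`W(ι_v(d(ϖ_v^m, 1)) g') = c_v(m) W(g')` for `g'_v = 1` (as the Whittaker coefficient of a smoothed
cuspidal Hecke eigenvector does, `WhittakerFactorizationGL2`), and a base point `d(y₀, a₀) k₀`
(`y₀, a₀` unit ideles, `k₀ ∈ K`) with `W ≠ 0`, the coordinate integral of
`∑_ξ |W(d(ξ) d(a₁, a₂) k)|²` over `a₁ ∈ z(r) y₀ P W` (a translate of the dyadic set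
`dyadicIdeleSet K r`), `a₂ ∈ C₂`, `k ∈ K_c` is **bounded below by
`I₀ ∑_{m} |∏_v c_v(m_v)|²`** over any finite set of profiles `m` supported in `Good` with
`N(m) r^d ∈ [1/2, 1]`, `I₀ > 0` independent of `r`:

* `diagGL2_map_adeleEval_mem_glInt_of_valued_eq_one` (`d(y_v, a_v) ∈ GL₂(𝒪_v)` for `|y_v| = |a_v| = 1`;
  unit ideles are the tree's `GaloisRepresentations.unitIdeles`),
  `map_adeleEval_mem_glInt_of_mem_standardMaximalCompactGL` (`k_v ∈ GL_n(𝒪_v)` for `k ∈ K`);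
* profile ideles: `map_adeleEval_profileIdele_of_mem`, `valued_snd_profileIdele`
  (`|(π_m)_v| = exp(-m_v)`), `ideleNorm_localUnits`, `nnnorm_eq_of_valued_eq_exp_neg_one`
  (`‖ϖ_v‖ = q_v⁻¹`), `profileNorm m = ∏ q_v^{m_v}`, `ideleNorm_profileIdele` (`‖π_m‖ = N(m)⁻¹`);
* the pieces: `profileIdele_smul_disjoint` (distinct profiles give disjoint `π_m Q`),
  `ideleNorm_profileIdele_mul_mem` (`π_m Q ⊆` the dyadic shell);
* `setLIntegral_smul_set_eq` (translation of set integrals);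
* `exists_meanSquare_lower_bound_of_valued_eq_one` (base point with `|y₀,ᵥ| = |a₀,ᵥ| = 1` only for
  `v ∈ Good`) and `exists_meanSquare_lower_bound` (`y₀, a₀ ∈ unitIdeles K`) — **the lower bound**: Tonelli (move
  `a₁` inside), translation by
  `y₀`, unfolding over `Kˣ` (`lintegral_shell_le_lintegral_dyadicIdeleSet_tsum`,
  `IdelicDyadicUnfolding`), restriction to the disjoint pieces, translation by `π_m`, the
  factorisation `whittaker_factorization_profileIdele`, and positivity of the remaining integral
  from the continuity of `W` at the base point.

Everything is proved; folklore (the mean-square/Rankin–Selberg method at real points, here in the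
soft form that avoids Eisenstein series: Jacquet–Shalika (1981), §5 for the classical route).
-/

noncomputable section

open MeasureTheory Measure NumberField IsDedekindDomain Matrix Set Filter Topology
open scoped MatrixGroups ENNReal NNReal Pointwise

namespace Literature.NumberTheory.Automorphic

/-! ### A translation lemma -/

section Translate

variable {G : Type*} [Group G] [MeasurableSpace G] [MeasurableMul G] (μ : Measure G) [μ.IsMulLeftInvariant]

/-- `∫⁻_{g S} f = ∫⁻_S f(g ·)` for a left-invariant measure. [folklore] -/
theorem setLIntegral_smul_set_eq (g : G) {S : Set G} (hS : MeasurableSet S) (f : G → ℝ≥0∞) :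
    ∫⁻ x in g • S, f x ∂μ = ∫⁻ y in S, f (g * y) ∂μ := by
  rw [← lintegral_indicator (hS.const_smul g), ← lintegral_indicator hS,
    ← lintegral_mul_left_eq_self (fun x => (g • S).indicator f x) g]
  refine lintegral_congr fun y => ?_
  by_cases hy : y ∈ S
  · rw [indicator_of_mem hy, indicator_of_mem (show g * y ∈ g • S from smul_mem_smul_set hy)]
  · rw [indicator_of_notMem hy, indicator_of_notMem]
    intro h
    apply hy
    have h' := mem_smul_set_iff_inv_smul_mem.1 h
    rwa [smul_eq_mul, inv_mul_cancel_left] at h'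

end Translate

section Lower

variable (K : Type) [Field K] [NumberField K]

attribute [local instance] adelicBorel borelSpace_adelic glTwoBorel borelSpace_glTwo

/-! ### Local components of ideles and of `K` -/

variable {K}

/-- If `|y_v| = 1` then `|(y⁻¹)_v| = 1`. [folklore] -/
theorem valued_snd_inv_eq_one {y : (AdeleRing (𝓞 K) K)ˣ} {v : HeightOneSpectrum (𝓞 K)}
    (hy : Valued.v (((y : AdeleRing (𝓞 K) K)).2 v) = 1) :
    Valued.v ((((y⁻¹ : (AdeleRing (𝓞 K) K)ˣ) : AdeleRing (𝓞 K) K)).2 v) = 1 := by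
  have hmul : ((y : AdeleRing (𝓞 K) K)).2 v * (((y⁻¹ : (AdeleRing (𝓞 K) K)ˣ) : AdeleRing (𝓞 K) K)).2 v = 1 := by
    rw [← ideleGroup_snd_mul_apply, mul_inv_cancel, ideleGroup_snd_one_apply]
  have h := Valuation.map_mul Valued.v (((y : AdeleRing (𝓞 K) K)).2 v) ((((y⁻¹ : (AdeleRing (𝓞 K) K)ˣ) : AdeleRing (𝓞 K) K)).2 v)
  rw [hmul, Valuation.map_one, hy, one_mul] at h
  exact h.symm

/-- `d(y_v, a_v) ∈ GL₂(𝒪_v)` when `|y_v| = |a_v| = 1` (a single place). [folklore] -/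
theorem diagGL2_map_adeleEval_mem_glInt_of_valued_eq_one {y a : (AdeleRing (𝓞 K) K)ˣ} {v : HeightOneSpectrum (𝓞 K)}
    (hy : Valued.v (((y : AdeleRing (𝓞 K) K)).2 v) = 1) (ha : Valued.v (((a : AdeleRing (𝓞 K) K)).2 v) = 1) :
    diagGL2 (Units.map (AdelicGroupData.adeleEval K v : AdeleRing (𝓞 K) K →* v.adicCompletion K) y)
      (Units.map (AdelicGroupData.adeleEval K v : AdeleRing (𝓞 K) K →* v.adicCompletion K) a) ∈
        glInt 2 (v.adicCompletion K) := by
  rw [mem_glInt_iff]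
  have h0 := (mem_integer_adicCompletion_iff K v).2
    (show Valued.v (0 : v.adicCompletion K) ≤ 1 by rw [Valuation.map_zero]; exact zero_le)
  refine ⟨?_, ?_⟩
  · rw [coe_diagGL2, Fin.forall_fin_two, Fin.forall_fin_two, Fin.forall_fin_two]
    exact ⟨⟨(mem_integer_adicCompletion_iff K v).2 hy.le, h0⟩, ⟨h0, (mem_integer_adicCompletion_iff K v).2 ha.le⟩⟩
  · rw [diagGL2_inv, coe_diagGL2, Fin.forall_fin_two, Fin.forall_fin_two, Fin.forall_fin_two]
    exact ⟨⟨(mem_integer_adicCompletion_iff K v).2 (valued_snd_inv_eq_one hy).le, h0⟩,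
      ⟨h0, (mem_integer_adicCompletion_iff K v).2 (valued_snd_inv_eq_one ha).le⟩⟩

/-- **`k_v ∈ GL₂(𝒪_v)` for `k ∈ K`** (general `n`). [folklore] -/
theorem map_adeleEval_mem_glInt_of_mem_standardMaximalCompactGL {n : ℕ} {k : GL (Fin n) (AdeleRing (𝓞 K) K)}
    (hk : k ∈ standardMaximalCompactGL n K) (v : HeightOneSpectrum (𝓞 K)) :
    Matrix.GeneralLinearGroup.map (AdelicGroupData.adeleEval K v) k ∈ glInt n (v.adicCompletion K) := by
  rw [mem_glInt_iff]
  refine ⟨fun i j => ?_, fun i j => ?_⟩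
  · exact (mem_integer_adicCompletion_iff K v).2 (snd_apply_mem_of_mem_standardMaximalCompactGL hk v i j).1
  · rw [← map_inv]
    exact (mem_integer_adicCompletion_iff K v).2 (snd_apply_mem_of_mem_standardMaximalCompactGL hk v i j).2

/-! ### Components and norms of profile ideles -/

/-- The `v`-component of `π_m^T` at `v ∈ T` is `ϖ_v^{m_v}`. [folklore] -/
theorem map_adeleEval_profileIdele_of_mem (ϖ : (v : HeightOneSpectrum (𝓞 K)) → (v.adicCompletion K)ˣ)
    (m : HeightOneSpectrum (𝓞 K) → ℕ) {T : Finset (HeightOneSpectrum (𝓞 K))} {v : HeightOneSpectrum (𝓞 K)} (hv : v ∈ T) :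
    Units.map (AdelicGroupData.adeleEval K v : AdeleRing (𝓞 K) K →* v.adicCompletion K) (profileIdele ϖ m T) = ϖ v ^ m v := by
  classical
  rw [profileIdele, map_prod, Finset.prod_eq_single v]
  · rw [map_pow, map_pow, map_adeleEval_localUnits]
  · intro w _ hwv
    rw [map_pow, map_pow, map_adeleEval_localUnits_of_ne (Ne.symm hwv), one_pow]
  · intro h; exact absurd hv h

/-- **Valuations of the components of `π_m`** (`T = supp m`): `|(π_m)_v| = exp(-m_v)` at every `v`.
[folklore] -/
theorem valued_snd_profileIdele (ϖ : (v : HeightOneSpectrum (𝓞 K)) → (v.adicCompletion K)ˣ)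
    (m : HeightOneSpectrum (𝓞 K) →₀ ℕ)
    (hϖ : ∀ v ∈ m.support, Valued.v (ϖ v : v.adicCompletion K) = WithZero.exp (-1 : ℤ)) (v : HeightOneSpectrum (𝓞 K)) :
    Valued.v (((profileIdele ϖ m m.support : (AdeleRing (𝓞 K) K)ˣ) : AdeleRing (𝓞 K) K).2 v) = WithZero.exp (-(m v : ℤ)) := by
  have key : ((profileIdele ϖ m m.support : (AdeleRing (𝓞 K) K)ˣ) : AdeleRing (𝓞 K) K).2 v =
      ((Units.map (AdelicGroupData.adeleEval K v : AdeleRing (𝓞 K) K →* v.adicCompletion K) (profileIdele ϖ m m.support) :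
        (v.adicCompletion K)ˣ) : v.adicCompletion K) := rfl
  rw [key]
  by_cases hv : v ∈ m.support
  · rw [map_adeleEval_profileIdele_of_mem ϖ m hv, Units.val_pow_eq_pow_val, Valuation.map_pow, hϖ v hv,
      ← WithZero.exp_nsmul]
    simp
  · rw [map_adeleEval_profileIdele_of_notMem ϖ m hv, Units.val_one, Valuation.map_one, Finsupp.notMem_support_iff.1 hv]
    simp

/-- The idele norm of a local idele is the local norm. [folklore] -/
theorem ideleNorm_localUnits (v : HeightOneSpectrum (𝓞 K)) (x : (v.adicCompletion K)ˣ) :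
    IdeleClassGroup.ideleNorm K (GaloisRepresentations.localUnits v x) = ‖(x : v.adicCompletion K)‖₊ := by
  rw [ideleNorm_apply]
  have h1 : (∏ w : InfinitePlace K, ‖((GaloisRepresentations.localUnits v x : (AdeleRing (𝓞 K) K)ˣ) : AdeleRing (𝓞 K) K).1 w‖₊ ^ w.mult) = 1 := by
    refine Finset.prod_eq_one fun w _ => ?_
    rw [GaloisRepresentations.localUnits_fst]
    change ‖(1 : w.Completion)‖₊ ^ w.mult = 1
    rw [nnnorm_one, one_pow]
  rw [h1, one_mul, finprod_eq_single _ v]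
  · rw [GaloisRepresentations.localUnits_snd_apply_self]
  · intro w hwv
    change ‖(GaloisRepresentations.finiteAdeleSingle v (x : v.adicCompletion K)) w‖₊ = 1
    rw [GaloisRepresentations.finiteAdeleSingle_apply_of_ne _ hwv, nnnorm_one]

/-- The local norm of a uniformizer is `q_v⁻¹`. [folklore] -/
theorem nnnorm_eq_of_valued_eq_exp_neg_one {v : HeightOneSpectrum (𝓞 K)} {ϖ : v.adicCompletion K}
    (hϖ : Valued.v ϖ = WithZero.exp (-1 : ℤ)) : ‖ϖ‖₊ = ((v.residueCard : ℝ≥0))⁻¹ := by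
  have h : ‖ϖ‖₊ = WithZeroMulInt.toNNReal (NumberField.HeightOneSpectrum.absNorm_ne_zero v) (Valued.v ϖ) :=
    NNReal.coe_injective (by rw [coe_nnnorm]; exact NumberField.FinitePlace.norm_def (K := K) (v := v) ϖ)
  have hexp : (WithZero.exp (-1 : ℤ) : WithZero (Multiplicative ℤ)) =
      ((Multiplicative.ofAdd (-1 : ℤ) : Multiplicative ℤ) : WithZero (Multiplicative ℤ)) := rfl
  rw [h, hϖ, hexp, WithZeroMulInt.toNNReal_neg_apply _ WithZero.coe_ne_zero, WithZero.unzero_coe, toAdd_ofAdd,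
    _root_.zpow_neg_one]
  rfl

/-- The **profile norm** `N(m) = ∏_v q_v^{m_v}`. [folklore] -/
def profileNorm (m : HeightOneSpectrum (𝓞 K) →₀ ℕ) : ℕ := ∏ v ∈ m.support, v.residueCard ^ m v

/-- `N(m) > 0`. [folklore] -/
theorem profileNorm_pos (m : HeightOneSpectrum (𝓞 K) →₀ ℕ) : 0 < profileNorm m :=
  Finset.prod_pos fun v _ => pow_pos (zero_lt_one.trans v.one_lt_residueCard) _

/-- **`‖π_m‖ = N(m)⁻¹`.** [folklore] -/
theorem ideleNorm_profileIdele (ϖ : (v : HeightOneSpectrum (𝓞 K)) → (v.adicCompletion K)ˣ)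
    (m : HeightOneSpectrum (𝓞 K) →₀ ℕ)
    (hϖ : ∀ v ∈ m.support, Valued.v (ϖ v : v.adicCompletion K) = WithZero.exp (-1 : ℤ)) :
    IdeleClassGroup.ideleNorm K (profileIdele ϖ m m.support) = ((profileNorm m : ℝ≥0))⁻¹ := by
  rw [profileIdele, map_prod, profileNorm, Nat.cast_prod, ← Finset.prod_inv_distrib]
  refine Finset.prod_congr rfl fun v hv => ?_
  rw [map_pow, map_pow, ideleNorm_localUnits, nnnorm_eq_of_valued_eq_exp_neg_one (hϖ v hv), Nat.cast_pow, inv_pow]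

/-! ### The pieces `π_m Q'` -/

/-- **Distinct profiles give disjoint pieces**: if `supp m, supp m' ⊆` the set where `ϖ` are
uniformizers and `Q ⊆` unit ideles, then `π_m Q ∩ π_{m'} Q ≠ ∅ ⟹ m = m'` (compare valuations of
the components). [folklore] -/
theorem profileIdele_smul_disjoint (ϖ : (v : HeightOneSpectrum (𝓞 K)) → (v.adicCompletion K)ˣ)
    {Good : Set (HeightOneSpectrum (𝓞 K))} (hϖ : ∀ v ∈ Good, Valued.v (ϖ v : v.adicCompletion K) = WithZero.exp (-1 : ℤ))
    {Q : Set (AdeleRing (𝓞 K) K)ˣ} (hQ : Q ⊆ (GaloisRepresentations.unitIdeles K : Set (AdeleRing (𝓞 K) K)ˣ))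
    {m m' : HeightOneSpectrum (𝓞 K) →₀ ℕ} (hm : ↑m.support ⊆ Good) (hm' : ↑m'.support ⊆ Good) (hne : m ≠ m') :
    Disjoint (profileIdele ϖ m m.support • Q) (profileIdele ϖ m' m'.support • Q) := by
  rw [Set.disjoint_left]
  rintro x ⟨q, hq, rfl⟩ ⟨q', hq', heq⟩
  have heq' : profileIdele ϖ m' m'.support * q' = profileIdele ϖ m m.support * q := heq
  apply hne
  ext v
  have h1 := valued_snd_profileIdele ϖ m (fun v hv => hϖ v (hm hv)) v
  have h2 := valued_snd_profileIdele ϖ m' (fun v hv => hϖ v (hm' hv)) v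
  have hq1 := GaloisRepresentations.mem_unitIdeles_iff.1 (hQ hq) v
  have hq2 := GaloisRepresentations.mem_unitIdeles_iff.1 (hQ hq') v
  have e1 : Valued.v (((profileIdele ϖ m m.support * q : (AdeleRing (𝓞 K) K)ˣ) : AdeleRing (𝓞 K) K).2 v) = WithZero.exp (-(m v : ℤ)) := by
    rw [ideleGroup_snd_mul_apply, Valuation.map_mul, h1, hq1, mul_one]
  have e2 : Valued.v (((profileIdele ϖ m' m'.support * q' : (AdeleRing (𝓞 K) K)ˣ) : AdeleRing (𝓞 K) K).2 v) = WithZero.exp (-(m' v : ℤ)) := by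
    rw [ideleGroup_snd_mul_apply, Valuation.map_mul, h2, hq2, mul_one]
  rw [heq', e1] at e2
  have := WithZero.exp_injective e2
  omega

/-- **The pieces lie in the dyadic shell**: for `q` with `‖q‖ ∈ (1/2, 2)` and a profile with
`N(m) r^d ∈ [1/2, 1]`, `‖π_m q‖ ∈ [r^d/2, 4 r^d]`. [folklore] -/
theorem ideleNorm_profileIdele_mul_mem (ϖ : (v : HeightOneSpectrum (𝓞 K)) → (v.adicCompletion K)ˣ)
    (m : HeightOneSpectrum (𝓞 K) →₀ ℕ)
    (hϖ : ∀ v ∈ m.support, Valued.v (ϖ v : v.adicCompletion K) = WithZero.exp (-1 : ℤ))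
    {R : ℝ} (hlo : 1 / 2 ≤ (profileNorm m : ℝ) * R) (hhi : (profileNorm m : ℝ) * R ≤ 1)
    {q : (AdeleRing (𝓞 K) K)ˣ} (hq1 : 1 / 2 < (IdeleClassGroup.ideleNorm K q : ℝ)) (hq2 : (IdeleClassGroup.ideleNorm K q : ℝ) < 2) :
    R / 2 ≤ (IdeleClassGroup.ideleNorm K (profileIdele ϖ m m.support * q) : ℝ) ∧
      (IdeleClassGroup.ideleNorm K (profileIdele ϖ m m.support * q) : ℝ) ≤ 4 * R := by
  have hN : (0 : ℝ) < profileNorm m := by exact_mod_cast profileNorm_pos m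
  rw [map_mul, ideleNorm_profileIdele ϖ m hϖ, NNReal.coe_mul, NNReal.coe_inv, NNReal.coe_natCast]
  constructor
  · -- R/2 ≤ N⁻¹ ‖q‖ since N R ≤ 1 and ‖q‖ > 1/2
    rw [div_le_iff₀ (by norm_num : (0:ℝ) < 2)]
    calc R = (profileNorm m : ℝ)⁻¹ * ((profileNorm m : ℝ) * R) := by field_simp
      _ ≤ (profileNorm m : ℝ)⁻¹ * 1 := by gcongr
      _ ≤ (profileNorm m : ℝ)⁻¹ * ((IdeleClassGroup.ideleNorm K q : ℝ) * 2) := by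
          gcongr; linarith
      _ = (profileNorm m : ℝ)⁻¹ * (IdeleClassGroup.ideleNorm K q : ℝ) * 2 := by ring
  · calc (profileNorm m : ℝ)⁻¹ * (IdeleClassGroup.ideleNorm K q : ℝ)
        ≤ (profileNorm m : ℝ)⁻¹ * 2 := by gcongr
      _ = 4 * ((profileNorm m : ℝ)⁻¹ * (1 / 2)) := by ring
      _ ≤ 4 * ((profileNorm m : ℝ)⁻¹ * ((profileNorm m : ℝ) * R)) := by gcongr
      _ = 4 * R := by field_simp

variable [MeasurableSpace (AdeleRing (𝓞 K) K)ˣ] [BorelSpace (AdeleRing (𝓞 K) K)ˣ]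

/-! ### The lower bound -/

/-- **The mean-square lower bound** (base point with unit components on `Good` only). Let
`W : GL₂(𝔸_K) → ℂ` be continuous, right invariant under
`ι_v(GL₂(𝒪_v))` and satisfying Shintani's relation
`W(ι_v(d(ϖ_v^m, 1)) g') = c_v(m) W(g')` (`g'_v = 1`) at every place `v` of a set `Good` of finite
places (`ϖ_v` uniformizers), and let `W(d(y₀, a₀) k₀) ≠ 0` with `|y₀,ᵥ| = |a₀,ᵥ| = 1` for `v ∈ Good`
and `k₀ ∈ K`.
Then there are a compact `C₂ ⊆ 𝔸_Kˣ`, a subset `K_c ⊆ K` and `I₀ > 0` such that for every `r` and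
every finite set `Ms` of profiles `m` supported in `Good` with `N(m) r^d ∈ [1/2, 1]`,
`I₀ · ∑_{m ∈ Ms} |∏_v c_v(m_v)|² ≤ ∫_{z(r) y₀ P W} ∫_{C₂} ∫_{K_c} ∑'_ξ |W(d(ξ) d(a₁,a₂) k)|²`.
Proof: move `a₁` inside (Tonelli), translate by `y₀` and unfold the sum over `Kˣ` against the
dyadic set (`lintegral_shell_le_lintegral_dyadicIdeleSet_tsum`), keep the disjoint pieces
`π_m Q' ⊆` shell (`Q'` a small neighbourhood of `1` in the unit ideles), translate by `π_m` and
factor `W(d(π_m y₀ q, a₂) k) = (∏ c_v(m_v)) W(d(y₀ q, a₂) k)` (`whittaker_factorization_profileIdele`);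
positivity of the remaining integral comes from the continuity of `W` at the base point.
[folklore] -/
theorem exists_meanSquare_lower_bound_of_valued_eq_one (μI : Measure (AdeleRing (𝓞 K) K)ˣ) [IsHaarMeasure μI]
    (μK : Measure ↥(standardMaximalCompactGL 2 K)) [IsHaarMeasure μK]
    {W : GL (Fin 2) (AdeleRing (𝓞 K) K) → ℂ} (hWc : Continuous W)
    {Good : Set (HeightOneSpectrum (𝓞 K))}
    (ϖ : (v : HeightOneSpectrum (𝓞 K)) → (v.adicCompletion K)ˣ)
    (hϖ : ∀ v ∈ Good, Valued.v (ϖ v : v.adicCompletion K) = WithZero.exp (-1 : ℤ))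
    (c : HeightOneSpectrum (𝓞 K) → ℕ → ℂ)
    (hSh : ∀ v ∈ Good, ∀ g' : GL (Fin 2) (AdeleRing (𝓞 K) K),
      Matrix.GeneralLinearGroup.map (AdelicGroupData.adeleEval K v) g' = 1 →
        ∀ m : ℕ, W (GLn.ofLocal 2 K v (diagGL2 (ϖ v ^ m) 1) * g') = c v m * W g')
    (hInv : ∀ v ∈ Good, ∀ k ∈ glInt 2 (v.adicCompletion K), ∀ y, W (y * GLn.ofLocal 2 K v k) = W y)
    {y₀ a₀ : (AdeleRing (𝓞 K) K)ˣ} (hy₀ : ∀ v ∈ Good, Valued.v (((y₀ : AdeleRing (𝓞 K) K)).2 v) = 1)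
    (ha₀ : ∀ v ∈ Good, Valued.v (((a₀ : AdeleRing (𝓞 K) K)).2 v) = 1)
    {k₀ : GL (Fin 2) (AdeleRing (𝓞 K) K)} (hk₀ : k₀ ∈ standardMaximalCompactGL 2 K)
    (hW0 : W (diagGL2 y₀ a₀ * k₀) ≠ 0) :
    ∃ C₂ : Set (AdeleRing (𝓞 K) K)ˣ, IsCompact C₂ ∧ ∃ Kc : Set ↥(standardMaximalCompactGL 2 K),
      ∃ I₀ : ℝ≥0∞, I₀ ≠ 0 ∧ ∀ (r : ℝ≥0ˣ) (Ms : Finset (HeightOneSpectrum (𝓞 K) →₀ ℕ)),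
        (∀ m ∈ Ms, ↑m.support ⊆ Good ∧
          1 / 2 ≤ (profileNorm m : ℝ) * ((r : ℝ≥0) : ℝ) ^ Module.finrank ℚ K ∧
          (profileNorm m : ℝ) * ((r : ℝ≥0) : ℝ) ^ Module.finrank ℚ K ≤ 1) →
        I₀ * ∑ m ∈ Ms, ‖∏ v ∈ m.support, c v (m v)‖ₑ ^ 2 ≤
          ∫⁻ a₁ in posRealIdele K r • (y₀ • (posRealIdeleSegment K * normOneIdeleCover K)), ∫⁻ a₂ in C₂, ∫⁻ k in Kc,
            ∑' ξ : Kˣ, ‖W (ratDiagGL2 K ξ * (diagGL2 a₁ a₂ * (k : GL (Fin 2) (AdeleRing (𝓞 K) K))))‖ₑ ^ 2 ∂μK ∂μI ∂μI := by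
  classical
  haveI : T2Space (AdeleRing (𝓞 K) K) := t2Space_adeleRing K
  haveI := locallyCompactSpace_adeleRing' K
  haveI := locallyCompactSpace_ideleGroup K
  haveI := secondCountableTopology_ideleGroup K
  haveI := t2Space_ideleGroup K
  haveI : Countable Kˣ := by
    haveI := countable_numberField K
    exact Function.Injective.countable (f := (Units.val : Kˣ → K)) Units.val_injective
  haveI : CompactSpace ↥(standardMaximalCompactGL 2 K) :=
    isCompact_iff_compactSpace.1 (isCompact_standardMaximalCompactGL 2 K)
  haveI : IsFiniteMeasure μK := CompactSpace.isFiniteMeasure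
  -- Step 0: neighbourhoods on which `|W| > ε`
  set ε : ℝ := ‖W (diagGL2 y₀ a₀ * k₀)‖ / 2 with hε
  have hεpos : 0 < ε := by rw [hε]; exact half_pos (norm_pos_iff.2 hW0)
  set Θ : (AdeleRing (𝓞 K) K)ˣ × (AdeleRing (𝓞 K) K)ˣ × ↥(standardMaximalCompactGL 2 K) → GL (Fin 2) (AdeleRing (𝓞 K) K) :=
    fun p => diagGL2 (y₀ * p.1) (a₀ * p.2.1) * (p.2.2 : GL (Fin 2) (AdeleRing (𝓞 K) K)) with hΘ
  have hΘc : Continuous Θ :=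
    (continuous_diagGL2.comp ((continuous_const.mul continuous_fst).prodMk
      (continuous_const.mul (continuous_fst.comp continuous_snd)))).mul
      (continuous_subtype_val.comp (continuous_snd.comp continuous_snd))
  set O : Set ((AdeleRing (𝓞 K) K)ˣ × (AdeleRing (𝓞 K) K)ˣ × ↥(standardMaximalCompactGL 2 K)) :=
    Θ ⁻¹' {g | ε < ‖W g‖} with hO
  have hOo : IsOpen O := (isOpen_lt continuous_const hWc.norm).preimage hΘc
  have hO1 : ((1 : (AdeleRing (𝓞 K) K)ˣ), (1 : (AdeleRing (𝓞 K) K)ˣ), (⟨k₀, hk₀⟩ : ↥(standardMaximalCompactGL 2 K))) ∈ O := by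
    change ε < ‖W (diagGL2 (y₀ * 1) (a₀ * 1) * k₀)‖
    rw [mul_one, mul_one, hε]
    linarith [norm_pos_iff.2 hW0]
  obtain ⟨U₁, hU₁, U₂₃, hU₂₃, hsub⟩ := mem_nhds_prod_iff.1 (hOo.mem_nhds hO1)
  obtain ⟨U₂, hU₂, U₃, hU₃, hsub'⟩ := mem_nhds_prod_iff.1 hU₂₃
  -- `Q'`: open neighbourhood of `1` in the unit ideles of norm in `(1/2, 2)`, inside `U₁`
  obtain ⟨U₁', hU₁'sub, hU₁'o, hU₁'1⟩ := mem_nhds_iff.1 hU₁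
  set Nrm : Set (AdeleRing (𝓞 K) K)ˣ := {q | 1 / 2 < (IdeleClassGroup.ideleNorm K q : ℝ) ∧ (IdeleClassGroup.ideleNorm K q : ℝ) < 2} with hNrm
  have hNrmo : IsOpen Nrm := by
    have hc : Continuous fun q : (AdeleRing (𝓞 K) K)ˣ => (IdeleClassGroup.ideleNorm K q : ℝ) :=
      NNReal.continuous_coe.comp (continuous_ideleNorm_holds K)
    exact (isOpen_lt continuous_const hc).inter (isOpen_lt hc continuous_const)
  set Q' : Set (AdeleRing (𝓞 K) K)ˣ := U₁' ∩ (GaloisRepresentations.unitIdeles K : Set (AdeleRing (𝓞 K) K)ˣ) ∩ Nrm with hQ'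
  have hQ'o : IsOpen Q' := (hU₁'o.inter (GaloisRepresentations.isOpen_unitIdeles K)).inter hNrmo
  have hQ'1 : (1 : (AdeleRing (𝓞 K) K)ˣ) ∈ Q' := by
    refine ⟨⟨hU₁'1, (GaloisRepresentations.unitIdeles K).one_mem⟩, ?_⟩
    change 1 / 2 < (IdeleClassGroup.ideleNorm K 1 : ℝ) ∧ (IdeleClassGroup.ideleNorm K 1 : ℝ) < 2
    rw [map_one, NNReal.coe_one]; norm_num
  have hQ'm : MeasurableSet Q' := hQ'o.measurableSet
  have hQ'pos : 0 < μI Q' := hQ'o.measure_pos μI ⟨1, hQ'1⟩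
  have hQ'unit : Q' ⊆ (GaloisRepresentations.unitIdeles K : Set (AdeleRing (𝓞 K) K)ˣ) := fun q hq => hq.1.2
  -- `C₂ = a₀ C'`, `C'` a compact neighbourhood of `1` inside `U₂ ∩` unit ideles
  obtain ⟨U₂', hU₂'sub, hU₂'o, hU₂'1⟩ := mem_nhds_iff.1 hU₂
  obtain ⟨C', hC'c, hC'1, hC'sub⟩ := exists_compact_subset (hU₂'o.inter (GaloisRepresentations.isOpen_unitIdeles K))
    ⟨hU₂'1, (GaloisRepresentations.unitIdeles K).one_mem⟩
  set C₂ : Set (AdeleRing (𝓞 K) K)ˣ := a₀ • C' with hC₂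
  have hC₂c : IsCompact C₂ := hC'c.smul a₀
  have hC₂m : MeasurableSet C₂ := hC₂c.isClosed.measurableSet
  have hC₂pos : 0 < μI C₂ := by
    refine lt_of_lt_of_le ?_ (measure_mono (Set.smul_set_mono interior_subset : a₀ • interior C' ⊆ C₂))
    rw [measure_smul]
    exact isOpen_interior.measure_pos μI ⟨1, hC'1⟩
  -- `Kc = U₃'`
  obtain ⟨U₃', hU₃'sub, hU₃'o, hU₃'1⟩ := mem_nhds_iff.1 hU₃
  set Kc : Set ↥(standardMaximalCompactGL 2 K) := U₃' with hKc
  have hKcm : MeasurableSet Kc := hU₃'o.measurableSet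
  have hKcpos : 0 < μK Kc := hU₃'o.measure_pos μK ⟨_, hU₃'1⟩
  -- the pointwise bound on `Q' × C₂ × Kc`
  have hptw : ∀ q ∈ Q', ∀ a₂ ∈ C₂, ∀ k ∈ Kc,
      ENNReal.ofReal ε ^ 2 ≤ ‖W (diagGL2 (y₀ * q) a₂ * (k : GL (Fin 2) (AdeleRing (𝓞 K) K)))‖ₑ ^ 2 := by
    intro q hq a₂ ha₂ k hk
    obtain ⟨a', ha', rfl⟩ := Set.mem_smul_set.1 ha₂
    have hmem : (q, a', k) ∈ O := hsub (Set.mk_mem_prod (hU₁'sub hq.1.1) (hsub' (Set.mk_mem_prod (hU₂'sub (hC'sub ha').1) (hU₃'sub hk))))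
    have hlt : ε < ‖W (diagGL2 (y₀ * q) (a₀ * a') * (k : GL (Fin 2) (AdeleRing (𝓞 K) K)))‖ := hmem
    rw [smul_eq_mul]
    gcongr
    rw [← ofReal_norm]
    exact ENNReal.ofReal_le_ofReal hlt.le
  -- the constant
  set I₀ : ℝ≥0∞ := ENNReal.ofReal ε ^ 2 * (μI C₂ * (μK Kc * μI Q')) with hI₀
  refine ⟨C₂, hC₂c, Kc, I₀, ?_, fun r Ms hMs => ?_⟩
  · refine mul_ne_zero (pow_ne_zero _ ?_) (mul_ne_zero hC₂pos.ne' (mul_ne_zero hKcpos.ne' hQ'pos.ne'))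
    rwa [Ne, ENNReal.ofReal_eq_zero, not_le]
  -- notation
  set Y₁ : Set (AdeleRing (𝓞 K) K)ˣ := y₀ • (posRealIdeleSegment K * normOneIdeleCover K) with hY₁
  set ρ := posRealIdele K r with hρ
  have hA₁ : ρ • Y₁ = y₀ • dyadicIdeleSet K r := by
    rw [hY₁, dyadicIdeleSet, smul_smul, smul_smul, mul_comm]
  have hmeasW : Measurable fun g : GL (Fin 2) (AdeleRing (𝓞 K) K) => ‖W g‖ₑ ^ 2 := hWc.measurable.enorm.pow_const 2
  -- the integrand after moving `a₁` inside
  set G : (AdeleRing (𝓞 K) K)ˣ → ↥(standardMaximalCompactGL 2 K) → (AdeleRing (𝓞 K) K)ˣ → ℝ≥0∞ :=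
    fun a₂ k y => ‖W (diagGL2 y a₂ * (k : GL (Fin 2) (AdeleRing (𝓞 K) K)))‖ₑ ^ 2 with hG
  have hGm : ∀ a₂ k, Measurable (G a₂ k) := fun a₂ k =>
    hmeasW.comp ((continuous_diagGL2.comp (continuous_id.prodMk continuous_const)).mul continuous_const).measurable
  have hratDiag : ∀ (ξ : Kˣ) (a₁ a₂ : (AdeleRing (𝓞 K) K)ˣ) (k : GL (Fin 2) (AdeleRing (𝓞 K) K)),
      ratDiagGL2 K ξ * (diagGL2 a₁ a₂ * k) = diagGL2 (principalIdele K ξ * a₁) a₂ * k := by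
    intro ξ a₁ a₂ k
    rw [← mul_assoc, ratDiagGL2, ← diagGL2_mul, one_mul]
  -- Step 1: the lower bound for fixed `(a₂, k)`
  have hstep : ∀ a₂ ∈ C₂, ∀ k ∈ Kc,
      (∑ m ∈ Ms, ‖∏ v ∈ m.support, c v (m v)‖ₑ ^ 2) * ∫⁻ q in Q', G a₂ k (y₀ * q) ∂μI ≤
        ∫⁻ a₁ in ρ • Y₁, ∑' ξ : Kˣ, G a₂ k (principalIdele K ξ * a₁) ∂μI := by
    intro a₂ ha₂ k hk
    have ha₂unit : a₀⁻¹ * a₂ ∈ GaloisRepresentations.unitIdeles K := by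
      obtain ⟨a', ha', rfl⟩ := Set.mem_smul_set.1 ha₂
      rw [smul_eq_mul, inv_mul_cancel_left]
      exact (hC'sub ha').2
    -- translate by `y₀` and unfold over `Kˣ`
    have hG'm : Measurable fun y => G a₂ k (y₀ * y) := (hGm a₂ k).comp (measurable_const_mul y₀)
    have hunf := lintegral_shell_le_lintegral_dyadicIdeleSet_tsum (K := K) μI r hG'm
    have htrans : ∫⁻ a₁ in ρ • Y₁, ∑' ξ : Kˣ, G a₂ k (principalIdele K ξ * a₁) ∂μI =
        ∫⁻ y in dyadicIdeleSet K r, ∑' ξ : Kˣ, G a₂ k (y₀ * (principalIdele K ξ * y)) ∂μI := by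
      rw [hA₁, setLIntegral_smul_set_eq μI y₀ (measurableSet_dyadicIdeleSet K r)
        (fun a₁ => ∑' ξ : Kˣ, G a₂ k (principalIdele K ξ * a₁))]
      refine lintegral_congr fun y => tsum_congr fun ξ => ?_
      rw [mul_left_comm]
    rw [htrans]
    refine le_trans ?_ hunf
    -- keep the disjoint pieces `π_m Q'`
    set shell : Set (AdeleRing (𝓞 K) K)ˣ := {x | ((r : ℝ≥0) : ℝ) ^ Module.finrank ℚ K / 2 ≤ (IdeleClassGroup.ideleNorm K x : ℝ) ∧
        (IdeleClassGroup.ideleNorm K x : ℝ) ≤ 4 * ((r : ℝ≥0) : ℝ) ^ Module.finrank ℚ K} with hshell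
    set piece : (HeightOneSpectrum (𝓞 K) →₀ ℕ) → Set (AdeleRing (𝓞 K) K)ˣ := fun m => profileIdele ϖ m m.support • Q' with hpiece
    have hpm : ∀ m, MeasurableSet (piece m) := fun m => hQ'm.const_smul _
    have hdisj : Set.PairwiseDisjoint (↑Ms : Set (HeightOneSpectrum (𝓞 K) →₀ ℕ)) piece := by
      intro m hm m' hm' hne
      exact profileIdele_smul_disjoint ϖ hϖ hQ'unit (hMs m hm).1 (hMs m' hm').1 hne
    have hsubshell : (⋃ m ∈ Ms, piece m) ⊆ shell := by
      intro x hx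
      obtain ⟨m, hm, hxm⟩ := Set.mem_iUnion₂.1 hx
      obtain ⟨q, hq, rfl⟩ := Set.mem_smul_set.1 hxm
      have hϖm : ∀ v ∈ m.support, Valued.v (ϖ v : v.adicCompletion K) = WithZero.exp (-1 : ℤ) :=
        fun v hv => hϖ v ((hMs m hm).1 hv)
      exact ideleNorm_profileIdele_mul_mem ϖ m hϖm (hMs m hm).2.1 (hMs m hm).2.2 hq.2.1 hq.2.2
    -- factorisation on each piece
    have hfac : ∀ m ∈ Ms, ∀ q ∈ Q',
        G a₂ k (y₀ * (profileIdele ϖ m m.support * q)) = ‖∏ v ∈ m.support, c v (m v)‖ₑ ^ 2 * G a₂ k (y₀ * q) := by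
      intro m hm q hq
      have hT : ∀ v ∈ m.support, v ∈ Good := fun v hv => (hMs m hm).1 hv
      have hyq : ∀ v ∈ Good, Valued.v ((((y₀ * q : (AdeleRing (𝓞 K) K)ˣ)) : AdeleRing (𝓞 K) K).2 v) = 1 := by
        intro v hv
        rw [ideleGroup_snd_mul_apply, Valuation.map_mul, hy₀ v hv, GaloisRepresentations.mem_unitIdeles_iff.1 (hQ'unit hq) v, mul_one]
      have ha₂' : ∀ v ∈ Good, Valued.v (((a₂ : AdeleRing (𝓞 K) K)).2 v) = 1 := by
        intro v hv
        have h := mul_inv_cancel_left a₀ a₂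
        rw [← h, ideleGroup_snd_mul_apply, Valuation.map_mul, ha₀ v hv, GaloisRepresentations.mem_unitIdeles_iff.1 ha₂unit v,
          mul_one]
      have hsplit : ∀ z : (AdeleRing (𝓞 K) K)ˣ, diagGL2 z a₂ * (k : GL (Fin 2) (AdeleRing (𝓞 K) K)) =
          diagGL2 z 1 * (diagGL2 1 a₂ * (k : GL (Fin 2) (AdeleRing (𝓞 K) K))) := by
        intro z
        rw [← mul_assoc, ← diagGL2_mul, mul_one, one_mul]
      have hzh : ∀ v ∈ m.support, Matrix.GeneralLinearGroup.map (AdelicGroupData.adeleEval K v)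
          (diagGL2 (y₀ * q) 1 * (diagGL2 1 a₂ * (k : GL (Fin 2) (AdeleRing (𝓞 K) K)))) ∈ glInt 2 (v.adicCompletion K) := by
        intro v hv
        rw [← hsplit, map_mul, map_adeleEval_diagGL2]
        exact mul_mem (diagGL2_map_adeleEval_mem_glInt_of_valued_eq_one (hyq v (hT v hv)) (ha₂' v (hT v hv)))
          (map_adeleEval_mem_glInt_of_mem_standardMaximalCompactGL k.2 v)
      have hW := whittaker_factorization_profileIdele (W := W) ϖ c m.support
        (fun v hv => hSh v (hT v hv)) (fun v hv => hInv v (hT v hv)) m (y₀ * q)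
        (diagGL2 1 a₂ * (k : GL (Fin 2) (AdeleRing (𝓞 K) K))) hzh
      change ‖W (diagGL2 (y₀ * (profileIdele ϖ m m.support * q)) a₂ * (k : GL (Fin 2) (AdeleRing (𝓞 K) K)))‖ₑ ^ 2 =
        ‖∏ v ∈ m.support, c v (m v)‖ₑ ^ 2 * ‖W (diagGL2 (y₀ * q) a₂ * (k : GL (Fin 2) (AdeleRing (𝓞 K) K)))‖ₑ ^ 2
      rw [mul_left_comm, hsplit, hW, ← hsplit, enorm_mul, mul_pow]
    calc (∑ m ∈ Ms, ‖∏ v ∈ m.support, c v (m v)‖ₑ ^ 2) * ∫⁻ q in Q', G a₂ k (y₀ * q) ∂μI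
        = ∑ m ∈ Ms, ‖∏ v ∈ m.support, c v (m v)‖ₑ ^ 2 * ∫⁻ q in Q', G a₂ k (y₀ * q) ∂μI := Finset.sum_mul _ _ _
      _ = ∑ m ∈ Ms, ∫⁻ q in Q', G a₂ k (y₀ * (profileIdele ϖ m m.support * q)) ∂μI := by
          refine Finset.sum_congr rfl fun m hm => ?_
          rw [← lintegral_const_mul _ hG'm]
          exact (setLIntegral_congr_fun hQ'm fun q hq => hfac m hm q hq).symm
      _ = ∑ m ∈ Ms, ∫⁻ x in piece m, G a₂ k (y₀ * x) ∂μI := by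
          refine Finset.sum_congr rfl fun m _ => ?_
          rw [setLIntegral_smul_set_eq μI _ hQ'm (fun y => G a₂ k (y₀ * y))]
      _ = ∫⁻ x in ⋃ m ∈ Ms, piece m, G a₂ k (y₀ * x) ∂μI := (lintegral_biUnion_finset hdisj (fun m _ => hpm m) _).symm
      _ ≤ ∫⁻ x in shell, G a₂ k (y₀ * x) ∂μI := lintegral_mono_set hsubshell
  -- Step 2: Tonelli — move `a₁` inside
  set f : (AdeleRing (𝓞 K) K)ˣ → (AdeleRing (𝓞 K) K)ˣ → ↥(standardMaximalCompactGL 2 K) → ℝ≥0∞ :=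
    fun a₁ a₂ k => ∑' ξ : Kˣ, G a₂ k (principalIdele K ξ * a₁) with hf
  have hfm : Measurable fun p : (AdeleRing (𝓞 K) K)ˣ × (AdeleRing (𝓞 K) K)ˣ × ↥(standardMaximalCompactGL 2 K) => f p.1 p.2.1 p.2.2 := by
    refine Measurable.tsum fun ξ => hmeasW.comp ?_
    exact ((continuous_diagGL2.comp ((continuous_const.mul continuous_fst).prodMk (continuous_fst.comp continuous_snd))).mul
      (continuous_subtype_val.comp (continuous_snd.comp continuous_snd))).measurable
  have hLHS : ∫⁻ a₁ in ρ • Y₁, ∫⁻ a₂ in C₂, ∫⁻ k in Kc,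
      ∑' ξ : Kˣ, ‖W (ratDiagGL2 K ξ * (diagGL2 a₁ a₂ * (k : GL (Fin 2) (AdeleRing (𝓞 K) K))))‖ₑ ^ 2 ∂μK ∂μI ∂μI =
      ∫⁻ a₂ in C₂, ∫⁻ k in Kc, ∫⁻ a₁ in ρ • Y₁, f a₁ a₂ k ∂μI ∂μK ∂μI := by
    have h0 : ∫⁻ a₁ in ρ • Y₁, ∫⁻ a₂ in C₂, ∫⁻ k in Kc,
        ∑' ξ : Kˣ, ‖W (ratDiagGL2 K ξ * (diagGL2 a₁ a₂ * (k : GL (Fin 2) (AdeleRing (𝓞 K) K))))‖ₑ ^ 2 ∂μK ∂μI ∂μI =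
        ∫⁻ a₁ in ρ • Y₁, ∫⁻ a₂ in C₂, ∫⁻ k in Kc, f a₁ a₂ k ∂μK ∂μI ∂μI := by
      refine lintegral_congr fun a₁ => lintegral_congr fun a₂ => lintegral_congr fun k => tsum_congr fun ξ => ?_
      rw [hratDiag]
    rw [h0]
    -- swap `a₁` and `a₂`
    have hm1 : Measurable fun p : ((AdeleRing (𝓞 K) K)ˣ × (AdeleRing (𝓞 K) K)ˣ) × ↥(standardMaximalCompactGL 2 K) =>
        f p.1.1 p.1.2 p.2 := by
      refine Measurable.tsum fun ξ => hmeasW.comp ?_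
      exact ((continuous_diagGL2.comp ((continuous_const.mul (continuous_fst.comp continuous_fst)).prodMk
        (continuous_snd.comp continuous_fst))).mul (continuous_subtype_val.comp continuous_snd)).measurable
    have h1 : ∫⁻ a₁ in ρ • Y₁, ∫⁻ a₂ in C₂, ∫⁻ k in Kc, f a₁ a₂ k ∂μK ∂μI ∂μI =
        ∫⁻ a₂ in C₂, ∫⁻ a₁ in ρ • Y₁, ∫⁻ k in Kc, f a₁ a₂ k ∂μK ∂μI ∂μI :=
      lintegral_lintegral_swap (hm1.lintegral_prod_right').aemeasurable
    refine h1.trans (lintegral_congr fun a₂ => ?_)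
    have hm2 : Measurable fun p : (AdeleRing (𝓞 K) K)ˣ × ↥(standardMaximalCompactGL 2 K) => f p.1 a₂ p.2 := by
      refine Measurable.tsum fun ξ => hmeasW.comp ?_
      exact ((continuous_diagGL2.comp ((continuous_const.mul continuous_fst).prodMk continuous_const)).mul
        (continuous_subtype_val.comp continuous_snd)).measurable
    exact lintegral_lintegral_swap hm2.aemeasurable
  rw [hLHS]
  -- Step 3: integrate the pointwise bound
  have hsum_ne_top : (∑ m ∈ Ms, ‖∏ v ∈ m.support, c v (m v)‖ₑ ^ 2) ≠ ⊤ :=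
    ENNReal.sum_ne_top.2 fun m _ => ENNReal.pow_ne_top enorm_ne_top
  calc I₀ * ∑ m ∈ Ms, ‖∏ v ∈ m.support, c v (m v)‖ₑ ^ 2
      = (∑ m ∈ Ms, ‖∏ v ∈ m.support, c v (m v)‖ₑ ^ 2) *
          ∫⁻ _a₂ in C₂, ∫⁻ _k in Kc, ∫⁻ _q in Q', ENNReal.ofReal ε ^ 2 ∂μI ∂μK ∂μI := by
        rw [setLIntegral_const, setLIntegral_const, setLIntegral_const, hI₀]
        ring
    _ ≤ (∑ m ∈ Ms, ‖∏ v ∈ m.support, c v (m v)‖ₑ ^ 2) *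
          ∫⁻ a₂ in C₂, ∫⁻ k in Kc, ∫⁻ q in Q', G a₂ k (y₀ * q) ∂μI ∂μK ∂μI := by
        gcongr ?_ * ?_
        · exact le_rfl
        refine setLIntegral_mono' hC₂m fun a₂ ha₂ => setLIntegral_mono' hKcm fun k hk =>
          setLIntegral_mono' hQ'm fun q hq => hptw q hq a₂ ha₂ k hk
    _ = ∫⁻ a₂ in C₂, ∫⁻ k in Kc, (∑ m ∈ Ms, ‖∏ v ∈ m.support, c v (m v)‖ₑ ^ 2) *
          ∫⁻ q in Q', G a₂ k (y₀ * q) ∂μI ∂μK ∂μI := by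
        rw [← lintegral_const_mul' _ _ hsum_ne_top]
        refine lintegral_congr fun a₂ => ?_
        rw [← lintegral_const_mul' _ _ hsum_ne_top]
    _ ≤ ∫⁻ a₂ in C₂, ∫⁻ k in Kc, ∫⁻ a₁ in ρ • Y₁, f a₁ a₂ k ∂μI ∂μK ∂μI :=
        setLIntegral_mono' hC₂m fun a₂ ha₂ => setLIntegral_mono' hKcm fun k hk => hstep a₂ ha₂ k hk

/-- **The mean-square lower bound.** Let `W : GL₂(𝔸_K) → ℂ` be continuous, right invariant under
`ι_v(GL₂(𝒪_v))` and satisfying Shintani's relation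
`W(ι_v(d(ϖ_v^m, 1)) g') = c_v(m) W(g')` (`g'_v = 1`) at every place `v` of a set `Good` of finite
places (`ϖ_v` uniformizers), and let `W(d(y₀, a₀) k₀) ≠ 0` with `y₀, a₀` unit ideles
(`GaloisRepresentations.unitIdeles`) and `k₀ ∈ K`.
Then there are a compact `C₂ ⊆ 𝔸_Kˣ`, a subset `K_c ⊆ K` and `I₀ > 0` such that for every `r` and
every finite set `Ms` of profiles `m` supported in `Good` with `N(m) r^d ∈ [1/2, 1]`,
`I₀ · ∑_{m ∈ Ms} |∏_v c_v(m_v)|² ≤ ∫_{z(r) y₀ P W} ∫_{C₂} ∫_{K_c} ∑'_ξ |W(d(ξ) d(a₁,a₂) k)|²`.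
Proof: move `a₁` inside (Tonelli), translate by `y₀` and unfold the sum over `Kˣ` against the
dyadic set (`lintegral_shell_le_lintegral_dyadicIdeleSet_tsum`), keep the disjoint pieces
`π_m Q' ⊆` shell (`Q'` a small neighbourhood of `1` in the unit ideles), translate by `π_m` and
factor `W(d(π_m y₀ q, a₂) k) = (∏ c_v(m_v)) W(d(y₀ q, a₂) k)` (`whittaker_factorization_profileIdele`);
positivity of the remaining integral comes from the continuity of `W` at the base point.
[folklore] -/
theorem exists_meanSquare_lower_bound (μI : Measure (AdeleRing (𝓞 K) K)ˣ) [IsHaarMeasure μI]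
    (μK : Measure ↥(standardMaximalCompactGL 2 K)) [IsHaarMeasure μK]
    {W : GL (Fin 2) (AdeleRing (𝓞 K) K) → ℂ} (hWc : Continuous W)
    {Good : Set (HeightOneSpectrum (𝓞 K))}
    (ϖ : (v : HeightOneSpectrum (𝓞 K)) → (v.adicCompletion K)ˣ)
    (hϖ : ∀ v ∈ Good, Valued.v (ϖ v : v.adicCompletion K) = WithZero.exp (-1 : ℤ))
    (c : HeightOneSpectrum (𝓞 K) → ℕ → ℂ)
    (hSh : ∀ v ∈ Good, ∀ g' : GL (Fin 2) (AdeleRing (𝓞 K) K),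
      Matrix.GeneralLinearGroup.map (AdelicGroupData.adeleEval K v) g' = 1 →
        ∀ m : ℕ, W (GLn.ofLocal 2 K v (diagGL2 (ϖ v ^ m) 1) * g') = c v m * W g')
    (hInv : ∀ v ∈ Good, ∀ k ∈ glInt 2 (v.adicCompletion K), ∀ y, W (y * GLn.ofLocal 2 K v k) = W y)
    {y₀ a₀ : (AdeleRing (𝓞 K) K)ˣ} (hy₀ : y₀ ∈ GaloisRepresentations.unitIdeles K) (ha₀ : a₀ ∈ GaloisRepresentations.unitIdeles K)
    {k₀ : GL (Fin 2) (AdeleRing (𝓞 K) K)} (hk₀ : k₀ ∈ standardMaximalCompactGL 2 K)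
    (hW0 : W (diagGL2 y₀ a₀ * k₀) ≠ 0) :
    ∃ C₂ : Set (AdeleRing (𝓞 K) K)ˣ, IsCompact C₂ ∧ ∃ Kc : Set ↥(standardMaximalCompactGL 2 K),
      ∃ I₀ : ℝ≥0∞, I₀ ≠ 0 ∧ ∀ (r : ℝ≥0ˣ) (Ms : Finset (HeightOneSpectrum (𝓞 K) →₀ ℕ)),
        (∀ m ∈ Ms, ↑m.support ⊆ Good ∧
          1 / 2 ≤ (profileNorm m : ℝ) * ((r : ℝ≥0) : ℝ) ^ Module.finrank ℚ K ∧
          (profileNorm m : ℝ) * ((r : ℝ≥0) : ℝ) ^ Module.finrank ℚ K ≤ 1) →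
        I₀ * ∑ m ∈ Ms, ‖∏ v ∈ m.support, c v (m v)‖ₑ ^ 2 ≤
          ∫⁻ a₁ in posRealIdele K r • (y₀ • (posRealIdeleSegment K * normOneIdeleCover K)), ∫⁻ a₂ in C₂, ∫⁻ k in Kc,
            ∑' ξ : Kˣ, ‖W (ratDiagGL2 K ξ * (diagGL2 a₁ a₂ * (k : GL (Fin 2) (AdeleRing (𝓞 K) K))))‖ₑ ^ 2 ∂μK ∂μI ∂μI :=
  exists_meanSquare_lower_bound_of_valued_eq_one μI μK hWc ϖ hϖ c hSh hInv
    (fun v _ => GaloisRepresentations.mem_unitIdeles_iff.1 hy₀ v) (fun v _ => GaloisRepresentations.mem_unitIdeles_iff.1 ha₀ v) hk₀ hW0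

end Lower

end Literature.NumberTheory.Automorphic
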